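import Literature.Barriers.Parity.SiegelZeroDichotomyChowlaStep3Cutoff
import Literature.NumberTheory.LFunctions.LargeValuesFourierDecay
import Literature.Analysis.Calculus.SmoothPlateauProfile
import HarnessLib

/-!
# The smooth interval cutoff `ψ_I` of Tao–Teräväinen 2022, Proposition 7.1: derivative bounds

Topic `Literature/Barriers/Parity`, sub-namespace `TaoTeravainen`; a tool file of the proof DAG of
`Literature.Barriers.Parity.TaoTeravainen2021_prop72_81_pair` (T. Tao, J. Teräväinen, *The
Hardy–Littlewood–Chowla conjecture in the presence of a Siegel zero*, J. London Math. Soc. (2) 106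
(2022), arXiv:2109.06291), proof of Proposition 7.1 (i): "We can approximate `1_I` by a cutoff
`ψ_I : ℝ → ℝ` supported on `I` obeying `ψ_I(y) = 1` whenever `dist(y, I) ≥ x^{1-2ε}`, and additionally
obeying the derivative estimates (7.4) `ψ_I^{(j)}(y) ≪_j x^{-(1-2ε)j}` for all `j ≥ 0` and `y ∈ ℝ`."
The cutoff itself is the tree's `Literature.Analysis.Calculus.plateauProfile A B Δ`
(`= S((y-A)/Δ) S((B-y)/Δ)`, `S = Real.smoothTransition`, file `SmoothPlateauProfile.lean`, with its
support/plateau lemmas); here we add what Proposition 7.1 needs on top of it, all PROVED, with `Δ`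
in place of `x^{1-2ε}`:

* `exists_bound_iteratedDeriv_smoothTransition` — all derivatives of `Real.smoothTransition` are
  bounded; `iteratedDeriv_smoothTransition_left/right` (chain rule for the affine maps);
* `abs_indicator_sub_plateauProfile_le` (`|1_I - ψ_I| ≤ 1_{[A,A+Δ)} + 1_{(B-Δ,B]}`),
  `hasCompactSupport_plateauProfile`, `tsupport_plateauProfile_subset` (no `A < B` needed);
* **(7.4)** `abs_iteratedDeriv_plateauProfile_le(')`: `|ψ_I^{(j)}(y)| ≤ K_j Δ^{-j}` with
  `K_j = plateauDerivConst j` depending only on `j` (Leibniz rule);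
* `sampledPlateau A B Δ n y = ψ_I(n y)` as a complex function (for the Poisson step of
  `SiegelZeroDichotomyPairHLSmoothSampling.lean`) and
  `integral_norm_iteratedDeriv_sampledPlateau_le`: `∫ |∂_y^m ψ_I(n y)| dy ≤ n^{m-1} K_m Δ^{-m} (B - A)`.
  [cite: TaoTeravainen2021, proof of Proposition 7.1, (7.4)]
-/

noncomputable section

open Real MeasureTheory Set Filter
open scoped ContDiff Topology

namespace Literature.Barriers.Parity

namespace TaoTeravainen

open Literature.NumberTheory.LFunctions (GuthMaynardFourier.integral_norm_le_of_bound_Icc)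
open Literature.Analysis.Calculus

/-! ### Derivative bounds for `Real.smoothTransition` -/

/-- All derivatives of `S = Real.smoothTransition` of positive order vanish off `[0, 1]` (there `S`
is locally constant). [folklore] -/
theorem iteratedDeriv_smoothTransition_eq_zero {j : ℕ} (hj : j ≠ 0) {y : ℝ} (hy : y < 0 ∨ 1 < y) :
    iteratedDeriv j Real.smoothTransition y = 0 := by
  rcases hy with hy | hy
  · have h : Real.smoothTransition =ᶠ[𝓝 y] fun _ => (0 : ℝ) := by
      filter_upwards [Iio_mem_nhds hy] with z hz
      exact Real.smoothTransition.zero_of_nonpos (le_of_lt hz)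
    rw [h.iteratedDeriv_eq j, iteratedDeriv_const, if_neg hj]
  · have h : Real.smoothTransition =ᶠ[𝓝 y] fun _ => (1 : ℝ) := by
      filter_upwards [Ioi_mem_nhds hy] with z hz
      exact Real.smoothTransition.one_of_one_le (le_of_lt hz)
    rw [h.iteratedDeriv_eq j, iteratedDeriv_const, if_neg hj]

/-- **All derivatives of `S` are bounded**: `|S^{(j)}| ≤ C_j`. [folklore] -/
theorem exists_bound_iteratedDeriv_smoothTransition (j : ℕ) :
    ∃ C : ℝ, 0 ≤ C ∧ ∀ y : ℝ, |iteratedDeriv j Real.smoothTransition y| ≤ C := by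
  rcases Nat.eq_zero_or_pos j with rfl | hj
  · refine ⟨1, zero_le_one, fun y => ?_⟩
    rw [iteratedDeriv_zero, abs_of_nonneg (Real.smoothTransition.nonneg y)]
    exact Real.smoothTransition.le_one y
  · have hc : Continuous (iteratedDeriv j Real.smoothTransition) :=
      Real.smoothTransition.contDiff.continuous_iteratedDeriv j (by exact_mod_cast le_top)
    obtain ⟨M, hM⟩ := (isCompact_Icc (a := (-1 : ℝ)) (b := 2)).exists_bound_of_continuousOn
      hc.continuousOn
    refine ⟨max M 0, le_max_right _ _, fun y => ?_⟩
    by_cases hy : y ∈ Icc (-1 : ℝ) 2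
    · have := hM y hy
      rw [Real.norm_eq_abs] at this
      exact this.trans (le_max_left _ _)
    · rw [mem_Icc, not_and_or, not_le, not_le] at hy
      rw [iteratedDeriv_smoothTransition_eq_zero hj.ne' (by rcases hy with h | h <;> [left; right] <;>
        linarith), abs_zero]
      exact le_max_right _ _

/-! ### The cutoff `ψ_I = plateauProfile A B Δ` -/

/-- `|ψ_I| ≤ 1`. [folklore] -/
theorem abs_plateauProfile_le_one (A B Δ y : ℝ) : |plateauProfile A B Δ y| ≤ 1 := by
  rw [abs_of_nonneg (plateauProfile_nonneg A B Δ y)]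
  exact plateauProfile_le_one A B Δ y

/-- `ψ_I` agrees with `1_{[A,B]}` at `y` unless `y` is within `Δ` of an endpoint:
`|1_{A ≤ y ≤ B} - ψ_I(y)| ≤ 1_{A ≤ y < A+Δ} + 1_{B-Δ < y ≤ B}`. [cite: TaoTeravainen2021, proof of
Proposition 7.1] -/
theorem abs_indicator_sub_plateauProfile_le {A B Δ y : ℝ} (hΔ : 0 < Δ) :
    |(if A ≤ y ∧ y ≤ B then (1 : ℝ) else 0) - plateauProfile A B Δ y| ≤
      (if A ≤ y ∧ y < A + Δ then 1 else 0) + (if B - Δ < y ∧ y ≤ B then 1 else 0) := by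
  have h0 := plateauProfile_nonneg A B Δ y
  have h1 := plateauProfile_le_one A B Δ y
  have hR1 : 0 ≤ (if A ≤ y ∧ y < A + Δ then (1 : ℝ) else 0) := by positivity
  have hR2 : 0 ≤ (if B - Δ < y ∧ y ≤ B then (1 : ℝ) else 0) := by positivity
  by_cases hin : A ≤ y ∧ y ≤ B
  · rw [if_pos hin]
    by_cases hmid : A + Δ ≤ y ∧ y ≤ B - Δ
    · rw [plateauProfile_eq_one hΔ ⟨hmid.1, hmid.2⟩, sub_self, abs_zero]
      positivity
    · have hle : |1 - plateauProfile A B Δ y| ≤ 1 := by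
        rw [abs_of_nonneg (by linarith)]; linarith
      refine hle.trans ?_
      rw [not_and_or, not_le, not_le] at hmid
      rcases hmid with h | h
      · rw [if_pos (show A ≤ y ∧ y < A + Δ from ⟨hin.1, h⟩)]; linarith
      · rw [if_pos (show B - Δ < y ∧ y ≤ B from ⟨h, hin.2⟩)]; linarith
  · rw [if_neg hin]
    rw [not_and_or, not_le, not_le] at hin
    rcases hin with h | h
    · rw [plateauProfile_eq_zero_of_le hΔ h.le, sub_zero, abs_zero]; positivity
    · rw [plateauProfile_eq_zero_of_ge hΔ h.le, sub_zero, abs_zero]; positivity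

/-- `ψ_I` has compact support (inside `[A, B]`) for `Δ > 0`. [folklore] -/
theorem hasCompactSupport_plateauProfile {A B Δ : ℝ} (hΔ : 0 < Δ) :
    HasCompactSupport (plateauProfile A B Δ) := by
  refine HasCompactSupport.of_support_subset_isCompact (isCompact_Icc (a := A) (b := B)) ?_
  intro y hy
  rw [Function.mem_support] at hy
  rw [mem_Icc]
  by_contra h
  rw [not_and_or, not_le, not_le] at h
  rcases h with h | h
  · exact hy (plateauProfile_eq_zero_of_le hΔ h.le)
  · exact hy (plateauProfile_eq_zero_of_ge hΔ h.le)

/-- `tsupport ψ_I ⊆ [A, B]` for `Δ > 0`. [folklore] -/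
theorem tsupport_plateauProfile_subset {A B Δ : ℝ} (hΔ : 0 < Δ) :
    tsupport (plateauProfile A B Δ) ⊆ Icc A B := by
  refine closure_minimal ?_ isClosed_Icc
  intro y hy
  rw [Function.mem_support] at hy
  rw [mem_Icc]
  by_contra h
  rw [not_and_or, not_le, not_le] at h
  rcases h with h | h
  · exact hy (plateauProfile_eq_zero_of_le hΔ h.le)
  · exact hy (plateauProfile_eq_zero_of_ge hΔ h.le)

/-! ### (7.4): the derivative bounds -/

/-- Iterated derivatives of `y ↦ S((y - A)/Δ)`. [folklore] -/
theorem iteratedDeriv_smoothTransition_left (A Δ : ℝ) (j : ℕ) :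
    iteratedDeriv j (fun y : ℝ => Real.smoothTransition ((y - A) / Δ)) =
      fun y => (1 / Δ) ^ j * iteratedDeriv j Real.smoothTransition ((y - A) / Δ) := by
  have h1 : (fun y : ℝ => Real.smoothTransition ((y - A) / Δ)) =
      fun y => (fun w => Real.smoothTransition ((1 / Δ) * w)) (y - A) := by
    funext y; simp only; congr 1; ring
  rw [h1, iteratedDeriv_comp_sub_const (n := j) (f := fun w => Real.smoothTransition ((1 / Δ) * w))
    (s := A), iteratedDeriv_comp_const_mul (Real.smoothTransition.contDiff (n := j)) (1 / Δ)]
  funext y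
  simp only
  congr 2
  ring

/-- Iterated derivatives of `y ↦ S((B - y)/Δ)`. [folklore] -/
theorem iteratedDeriv_smoothTransition_right (B Δ : ℝ) (j : ℕ) :
    iteratedDeriv j (fun y : ℝ => Real.smoothTransition ((B - y) / Δ)) =
      fun y => (-1 : ℝ) ^ j * ((1 / Δ) ^ j * iteratedDeriv j Real.smoothTransition ((B - y) / Δ)) := by
  have h1 : (fun y : ℝ => Real.smoothTransition ((B - y) / Δ)) =
      fun y => (fun w => Real.smoothTransition ((1 / Δ) * w)) (B - y) := by
    funext y; simp only; congr 1; ring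
  rw [h1, iteratedDeriv_comp_const_sub (n := j) (f := fun w => Real.smoothTransition ((1 / Δ) * w))
    (s := B), iteratedDeriv_comp_const_mul (Real.smoothTransition.contDiff (n := j)) (1 / Δ)]
  funext y
  simp only [smul_eq_mul]
  congr 3
  ring

/-- Pointwise Leibniz bound for real functions: `|(fg)^{(k)}(x)| ≤ ∑_i C(k,i) K_i G_{k-i}`.
[folklore] -/
theorem abs_iteratedDeriv_mul_le_of_bounds {f g : ℝ → ℝ} {x : ℝ} {k : ℕ}
    (hf : ContDiffAt ℝ k f x) (hg : ContDiffAt ℝ k g x) {K G : ℕ → ℝ}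
    (hK : ∀ i ≤ k, |iteratedDeriv i f x| ≤ K i) (hG : ∀ i ≤ k, |iteratedDeriv i g x| ≤ G i) :
    |iteratedDeriv k (f * g) x| ≤ ∑ i ∈ Finset.range (k + 1), (k.choose i) * K i * G (k - i) := by
  rw [iteratedDeriv_mul hf hg]
  refine (Finset.abs_sum_le_sum_abs _ _).trans (Finset.sum_le_sum fun i hi => ?_)
  rw [Finset.mem_range] at hi
  rw [abs_mul, abs_mul, Nat.abs_cast]
  have h1 := hK i (by omega)
  have h2 := hG (k - i) (by omega)
  have h3 : 0 ≤ K i := (abs_nonneg _).trans h1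
  gcongr

/-- **(7.4)**: `|ψ_I^{(j)}(y)| ≤ K_j Δ^{-j}` for all `j ≥ 0`, `y ∈ ℝ`, `Δ > 0`, with `K_j` depending
only on `j`. [cite: TaoTeravainen2021, proof of Proposition 7.1, (7.4)] -/
theorem abs_iteratedDeriv_plateauProfile_le (j : ℕ) :
    ∃ K : ℝ, 0 ≤ K ∧ ∀ (A B Δ : ℝ), 0 < Δ → ∀ y : ℝ,
      |iteratedDeriv j (plateauProfile A B Δ) y| ≤ K / Δ ^ j := by
  choose C hC0 hC using exists_bound_iteratedDeriv_smoothTransition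
  refine ⟨∑ i ∈ Finset.range (j + 1), (j.choose i) * C i * C (j - i), Finset.sum_nonneg fun i _ => by
    have := hC0 i; have := hC0 (j - i); positivity, fun A B Δ hΔ y => ?_⟩
  have hf : ContDiffAt ℝ j (fun y : ℝ => Real.smoothTransition ((y - A) / Δ)) y :=
    (Real.smoothTransition.contDiff.comp ((contDiff_id.sub contDiff_const).div_const Δ)).contDiffAt
  have hg : ContDiffAt ℝ j (fun y : ℝ => Real.smoothTransition ((B - y) / Δ)) y :=
    (Real.smoothTransition.contDiff.comp ((contDiff_const.sub contDiff_id).div_const Δ)).contDiffAt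
  have hK : ∀ i ≤ j, |iteratedDeriv i (fun y : ℝ => Real.smoothTransition ((y - A) / Δ)) y| ≤
      C i / Δ ^ i := by
    intro i _
    rw [iteratedDeriv_smoothTransition_left, abs_mul, abs_pow, abs_of_pos (by positivity), one_div,
      inv_pow, ← div_eq_inv_mul]
    exact div_le_div_of_nonneg_right (hC i _) (by positivity)
  have hG : ∀ i ≤ j, |iteratedDeriv i (fun y : ℝ => Real.smoothTransition ((B - y) / Δ)) y| ≤
      C i / Δ ^ i := by
    intro i _
    rw [iteratedDeriv_smoothTransition_right, abs_mul, abs_mul, abs_pow, abs_pow, abs_neg, abs_one,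
      one_pow, one_mul, abs_of_pos (by positivity : (0 : ℝ) < 1 / Δ), one_div, inv_pow,
      ← div_eq_inv_mul]
    exact div_le_div_of_nonneg_right (hC i _) (by positivity)
  have h := abs_iteratedDeriv_mul_le_of_bounds hf hg hK hG
  have heq : (fun y : ℝ => Real.smoothTransition ((y - A) / Δ)) * (fun y : ℝ => Real.smoothTransition ((B - y) / Δ))
      = plateauProfile A B Δ := by
    funext y; rfl
  rw [heq] at h
  refine h.trans (le_of_eq ?_)
  rw [Finset.sum_div]
  refine Finset.sum_congr rfl fun i hi => ?_
  rw [Finset.mem_range] at hi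
  have hΔi : Δ ^ j = Δ ^ i * Δ ^ (j - i) := by rw [← pow_add]; congr 1; omega
  rw [hΔi]
  field_simp

/-- The derivative bound with one fixed constant `K_j` chosen once and for all. [folklore] -/
def plateauDerivConst (j : ℕ) : ℝ := (abs_iteratedDeriv_plateauProfile_le j).choose

/-- `K_j ≥ 0`. [folklore] -/
theorem plateauDerivConst_nonneg (j : ℕ) : 0 ≤ plateauDerivConst j :=
  (abs_iteratedDeriv_plateauProfile_le j).choose_spec.1

/-- **(7.4)** with the fixed constants: `|ψ_I^{(j)}(y)| ≤ K_j/Δ^j`. [cite: TaoTeravainen2021, proof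
of Proposition 7.1, (7.4)] -/
theorem abs_iteratedDeriv_plateauProfile_le' (j : ℕ) {A B Δ : ℝ} (hΔ : 0 < Δ) (y : ℝ) :
    |iteratedDeriv j (plateauProfile A B Δ) y| ≤ plateauDerivConst j / Δ ^ j :=
  (abs_iteratedDeriv_plateauProfile_le j).choose_spec.2 A B Δ hΔ y

/-- All derivatives of a real function vanish outside its topological support. [folklore] -/
theorem iteratedDeriv_eq_zero_of_notMem_tsupport_real {f : ℝ → ℝ} {x : ℝ} (hx : x ∉ tsupport f)
    (k : ℕ) : iteratedDeriv k f x = 0 := by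
  have h : f =ᶠ[𝓝 x] fun _ => (0 : ℝ) := notMem_tsupport_iff_eventuallyEq.mp hx
  rw [h.iteratedDeriv_eq k, iteratedDeriv_const]
  split_ifs <;> rfl

/-! ### The sampled weight `y ↦ ψ_I(n y)` as a complex function -/

/-- The complex-valued sampled cutoff `y ↦ ψ_I(n y)`. [cite: TaoTeravainen2021, proof of
Proposition 7.1] -/
def sampledPlateau (A B Δ : ℝ) (n : ℝ) (y : ℝ) : ℂ :=
  ((plateauProfile A B Δ (n * y) : ℝ) : ℂ)

/-- `y ↦ ψ_I(n y)` is smooth. [folklore] -/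
theorem contDiff_sampledPlateau (A B Δ n : ℝ) : ContDiff ℝ ∞ (sampledPlateau A B Δ n) := by
  unfold sampledPlateau
  exact Complex.ofRealCLM.contDiff.comp ((contDiff_plateauProfile A B Δ).comp
    (contDiff_const.mul contDiff_id))

/-- `y ↦ ψ_I(n y)` has compact support for `n ≠ 0`, `Δ > 0`. [folklore] -/
theorem hasCompactSupport_sampledPlateau {A B Δ n : ℝ} (hΔ : 0 < Δ) (hn : n ≠ 0) :
    HasCompactSupport (sampledPlateau A B Δ n) := by
  unfold sampledPlateau
  have h1 : HasCompactSupport (fun y : ℝ => plateauProfile A B Δ (n * y)) := by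
    have := (hasCompactSupport_plateauProfile (A := A) (B := B) hΔ).comp_smul hn
    simpa [smul_eq_mul] using this
  exact h1.comp_left Complex.ofReal_zero

/-- The iterated derivatives of the sampled cutoff: `∂_y^m ψ_I(n y) = n^m ψ_I^{(m)}(n y)`.
[folklore] -/
theorem iteratedDeriv_sampledPlateau (A B Δ n : ℝ) (m : ℕ) :
    iteratedDeriv m (sampledPlateau A B Δ n) =
      fun y => ((n ^ m * iteratedDeriv m (plateauProfile A B Δ) (n * y) : ℝ) : ℂ) := by
  unfold sampledPlateau
  have h1 : (fun y : ℝ => ((plateauProfile A B Δ (n * y) : ℝ) : ℂ)) =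
      fun y => (fun w : ℝ => ((plateauProfile A B Δ w : ℝ) : ℂ)) (n * y) := rfl
  rw [h1, iteratedDeriv_comp_const_smul (n := m)
    (f := fun w : ℝ => ((plateauProfile A B Δ w : ℝ) : ℂ))
    (Complex.ofRealCLM.contDiff.comp ((contDiff_plateauProfile A B Δ).of_le
      (by exact_mod_cast le_top))) n,
    iteratedDeriv_ofReal_comp (contDiff_plateauProfile A B Δ) m]
  funext y
  rw [Complex.real_smul]
  push_cast
  ring

/-- **The `L¹` bound for the Poisson step**: for `n > 0`, `Δ > 0`, `A ≤ B`,
`∫ |∂_y^m ψ_I(n y)| dy ≤ n^{m-1} K_m Δ^{-m} (B - A)`. [cite: TaoTeravainen2021, proof of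
Proposition 7.1] -/
theorem integral_norm_iteratedDeriv_sampledPlateau_le {A B Δ n : ℝ} (hΔ : 0 < Δ) (hn : 0 < n)
    (hAB : A ≤ B) (m : ℕ) (hm : 1 ≤ m) :
    ∫ y, ‖iteratedDeriv m (sampledPlateau A B Δ n) y‖ ≤
      n ^ (m - 1) * (plateauDerivConst m / Δ ^ m) * (B - A) := by
  rw [iteratedDeriv_sampledPlateau]
  have hsupp : ∀ y ∉ Icc (A / n) (B / n), ((n ^ m * iteratedDeriv m (plateauProfile A B Δ) (n * y) : ℝ) : ℂ) = 0 := by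
    intro y hy
    have hny : n * y ∉ tsupport (plateauProfile A B Δ) := by
      intro h
      have h' := tsupport_plateauProfile_subset hΔ h
      apply hy
      rw [mem_Icc] at h' ⊢
      constructor
      · rw [div_le_iff₀ hn]; linarith [h'.1]
      · rw [le_div_iff₀ hn]; linarith [h'.2]
    rw [iteratedDeriv_eq_zero_of_notMem_tsupport_real hny m, mul_zero, Complex.ofReal_zero]
  have hbound : ∀ y : ℝ, ‖((n ^ m * iteratedDeriv m (plateauProfile A B Δ) (n * y) : ℝ) : ℂ)‖ ≤
      n ^ m * (plateauDerivConst m / Δ ^ m) := by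
    intro y
    rw [Complex.norm_real, Real.norm_eq_abs, abs_mul, abs_pow, abs_of_pos hn]
    exact mul_le_mul_of_nonneg_left (abs_iteratedDeriv_plateauProfile_le' m hΔ _) (by positivity)
  have h := GuthMaynardFourier.integral_norm_le_of_bound_Icc (div_le_div_of_nonneg_right hAB hn.le)
    hbound hsupp
  refine h.trans (le_of_eq ?_)
  have hpow : n ^ m = n ^ (m - 1) * n := by rw [← pow_succ, Nat.sub_add_cancel hm]
  rw [hpow]
  field_simp

end TaoTeravainen

end Literature.Barriers.Parity
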